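import Mathlib
import Summits.NavierStokesRegularity.OSWSelfSimilar.TypeIIInnerLimitMaster
import HarnessLib
/-!
# The Z1 inner-object master theorem: the ANALYTIC CORE, with the near-max points and `tₖ → T⋆` exported (zone Z1
# TEMPLATE §T1.4-I (I-2)–(I-5), (C4)/(E0) preparation; kernel, unconditional)

HONEST FRAMING (cell ns-blowup GROUP B «PROFILE SEARCH», zone Z1; D-0035/D-0074): part XXXIV of the Z1 dictionary. Part
XXXII (`innerObject_master_of_singularity`) runs on K8's standing hypotheses (`IsMaximalSmoothSolution 1 0 u p T⋆`,
Leray–Hopf, bounded sub-slabs, axisymmetric slices, `|Γ(0,·)| ≤ Mₛ`) and uses the Leray–Hopf / maximality pair for exactly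
two things: the energy bound on closed sub-slabs and unboundedness on `[0, T⋆)`. This file isolates the ANALYTIC CORE —
the same conclusion from `IsClassicalNSSolutionOn (Ico 0 T⋆) 1 0 u p` + axisymmetric slices + energy and sup bounds on
closed sub-slabs + `|Γ(0,·)| ≤ Mₛ` + unboundedness — so that part XXXV can feed it a solution MODIFIED OFF THE SLAB
(the datum-level theorem: K8's «bounded on closed sub-slabs» and «axisymmetric at all times» become consequences of
`HasRapidSpatialDecay (u 0)` + `IsAxisymmetric (u 0)`), and it EXPORTS two pieces of the construction the census needs
for (C4)/(E0): the near-max points `xₖ` (`λₖ‖u(tₖ, xₖ)‖ → 1`, so `‖u(tₖ, xₖ)‖ ≍ λₖ⁻¹ → ∞`) with `‖xₖ − cₖ‖ ≤ D λₖ`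
(the centre is within `O(λₖ) = O(‖u‖_∞⁻¹)` of a near-maximum, in BOTH cases A/B), and `tₖ → T⋆`.

`innerObject_master_core` — conclusion = part XXXII's conclusion verbatim, plus `Tendsto tn atTop (𝓝 T⋆)`, the near-max
points and the distance bound.

**Nothing here asserts that a singular solution exists or that (AX-L) holds or fails.** «violates: n/a — dictionary»;
bears_on LADDER-NS N5/Z1 → N1 linear core / N0⁻. Author: ns-blowup-profile-eng-1 g9, 2026-08-27.
-/

open Real Filter Topology Set MeasureTheory Function Bornology
open scoped ENNReal NNReal
open Literature.Analysis.FluidPDE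

namespace Summit.NavierStokesRegularity.OSWSelfSimilar
namespace TypeIIModulationDictionary

section MasterCore

variable {T Mₛ : ℝ} {u : ℝ → EuclideanSpace ℝ (Fin 3) → EuclideanSpace ℝ (Fin 3)}
  {p : ℝ → EuclideanSpace ℝ (Fin 3) → ℝ}

/-- The meridional near-max point `r e₀ + z e₂` is at distance `|r|` from the axis point `z e₂`. [new here — elementary] -/
theorem norm_meridional_sub_axisPoint (r z : ℝ) :
    ‖(EuclideanSpace.single 0 r + EuclideanSpace.single 2 z : EuclideanSpace ℝ (Fin 3)) -
      EuclideanSpace.single 2 z‖ = |r| := by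
  rw [add_sub_cancel_right, PiLp.norm_single, Real.norm_eq_abs]

/-- **THE Z1 INNER-OBJECT MASTER THEOREM — ANALYTIC CORE (unconditional; every rider on ONE subsequence; near-max points
and `tₖ → T⋆` exported).** Hypotheses: `(u, p)` classical (`ν = 1`, unforced) on `[0, T⋆) × ℝ³`, `T⋆ > 0`, axisymmetric
slices, energy and sup bounds on every closed sub-slab `[0, S] × ℝ³` (`S < T⋆`), `|Γ(0, ·)| ≤ Mₛ`, and `u` unbounded on
`[0, T⋆) × ℝ³`. Conclusion: gauge N-a zoom data `tₖ ∈ [T⋆/2, T⋆)`, `tₖ → T⋆`, `λₖ > 0 → 0`, `λₖ‖u‖ ≤ 1` on `[0, tₖ]`,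
centres `cₖ` and NEAR-MAX POINTS `xₖ` with `λₖ‖u(tₖ, xₖ)‖ → 1` and `‖xₖ − cₖ‖ ≤ D λₖ`, and ONE subsequence `φ` along which
the zoom converges to a KNSS blow-up limit `W` (with the Oseen identity), the zoomed vorticity converges to `curl W`, and
EXACTLY ONE of (α) `W ≡ c`, `‖c‖ = 1`, `c₁ = 0`, zoomed vorticity `→ 0`; (β) centres on the axis, `W` refutes
`AxisymmetricLiouvilleBoundedSwirl` with every (I-5) rider (part XXXII's list verbatim). [new here — dictionary;
unconditional] -/
theorem innerObject_master_core (hT : 0 < T) (hu : IsClassicalNSSolutionOn (Ico 0 T) 1 0 u p)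
    (haxi : ∀ t, IsAxisymmetric (u t))
    (hE : ∀ S < T, ∃ C : ℝ≥0∞, C < ⊤ ∧ ∀ t ∈ Icc 0 S, ∫⁻ x, ‖u t x‖ₑ ^ 2 ≤ C)
    (hbdd : ∀ S < T, ∃ N : ℝ, 0 < N ∧ ∀ t ∈ Icc 0 S, ∀ x, ‖u t x‖ ≤ N) (hMₛ : ∀ x, |swirl (u 0) x| ≤ Mₛ)
    (hunb : ∀ N : ℝ, ∃ t ∈ Ico 0 T, ∃ x : EuclideanSpace ℝ (Fin 3), N < ‖u t x‖) :
    ∃ (tn lamn : ℕ → ℝ) (cn xn : ℕ → EuclideanSpace ℝ (Fin 3)) (φ : ℕ → ℕ)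
      (W : ℝ → EuclideanSpace ℝ (Fin 3) → EuclideanSpace ℝ (Fin 3)),
      (∀ k, T / 2 ≤ tn k ∧ tn k < T) ∧ Tendsto tn atTop (𝓝 T) ∧ (∀ k, 0 < lamn k) ∧ Tendsto lamn atTop (𝓝 0) ∧
      (∀ k, ∀ t ∈ Icc 0 (tn k), ∀ x, lamn k * ‖u t x‖ ≤ 1) ∧
      Tendsto (fun k => lamn k * ‖u (tn k) (xn k)‖) atTop (𝓝 1) ∧ (∃ D : ℝ, ∀ k, ‖xn k - cn k‖ ≤ D * lamn k) ∧
      StrictMono φ ∧ IsKNSSBlowupLimit W ∧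
      (∀ s < 0, TendstoLocallyUniformly
        (fun k => (lamn (φ k) • stPull (lamn (φ k) ^ 2) (lamn (φ k)) (tn (φ k)) (cn (φ k)) u) s) (W s) atTop) ∧
      (∀ s t : ℝ, s < t → t < 0 → ∀ x,
        W t x = Literature.Analysis.UnboundedOperators.heatExtension (W s) (t - s) x - oseenDuhamel 1 s W W t x) ∧
      (∀ s < 0, ∀ y : EuclideanSpace ℝ (Fin 3), Tendsto (fun j => lamn (φ j) ^ 2 •
        curl (u (tn (φ j) + lamn (φ j) ^ 2 * s)) (cn (φ j) + lamn (φ j) • y)) atTop (𝓝 (curl (W s) y))) ∧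
      (((∃ c : EuclideanSpace ℝ (Fin 3), ‖c‖ = 1 ∧ c 1 = 0 ∧ ∀ s < 0, ∀ y : EuclideanSpace ℝ (Fin 3), W s y = c) ∧
          ∀ s < 0, ∀ y : EuclideanSpace ℝ (Fin 3), Tendsto (fun j => lamn (φ j) ^ 2 •
            curl (u (tn (φ j) + lamn (φ j) ^ 2 * s)) (cn (φ j) + lamn (φ j) • y)) atTop (𝓝 0)) ∨
        ((∀ k, cn k 0 = 0 ∧ cn k 1 = 0) ∧
          ¬ Summit.NavierStokesRegularity.NavierStokesRegularity.AxisymmetricLiouvilleBoundedSwirl ∧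
          (∀ s < 0, IsAxisymmetric (W s)) ∧ (∀ s < 0, ∀ y : EuclideanSpace ℝ (Fin 3), |swirl (W s) y| ≤ Mₛ) ∧
          (∃ s < 0, ∃ x : EuclideanSpace ℝ (Fin 3), W s x ≠ W s 0) ∧
          (∃ s < 0, ∃ y : EuclideanSpace ℝ (Fin 3), curl (W s) y ≠ 0) ∧
          (∃ s < 0, ∃ y : EuclideanSpace ℝ (Fin 3), swirl (W s) y ≠ 0 ∧
            Tendsto (fun k => swirl (u (tn (φ k) + lamn (φ k) ^ 2 * s)) (cn (φ k) + lamn (φ k) • y)) atTop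
              (𝓝 (swirl (W s) y))) ∧
          (∀ C : ℝ, ∃ s < 0, ∃ x : EuclideanSpace ℝ (Fin 3), C < cylRadius x * ‖poloidalPart (W s) x‖) ∧
          (∀ c C : ℝ, ∃ s < 0, ∃ x : EuclideanSpace ℝ (Fin 3), C < cylRadius x * ‖poloidalPart (W s) x - c • eZ‖) ∧
          (∀ q : ℝ≥0∞, 1 ≤ q → q < ⊤ → ∀ K : ℝ≥0, ∃ s < 0, (K : ℝ≥0∞) < eLpNorm (swirl (W s)) q volume) ∧
          (∃ ε : ℝ, 0 < ε ∧ ∀ R : ℝ, ∃ s < 0, ∃ x : EuclideanSpace ℝ (Fin 3),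
            R ≤ cylRadius x ∧ ε < |swirl (W s) x|) ∧
          ∃ ε₀ ∈ Set.Ioo (0 : ℝ) 1, ∀ L R₀ : ℝ, ∃ s < 0, ∃ x : EuclideanSpace ℝ (Fin 3),
            R₀ ≤ cylRadius x ∧ ε₀ * L ^ 2 / cylRadius x < |swirl (W s) x ^ 2 - L ^ 2|)) := by
  have hT2 : 0 < T / 2 := by positivity
  obtain ⟨tn, lamn, rn, zn, htn, hlam, hlam0, hrn, hgauge, hnear⟩ :=
    exists_meridional_zoom_data_of_unbounded hT haxi hbdd hunb
  -- the near-max points and `tₖ → T⋆`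
  set xn : ℕ → EuclideanSpace ℝ (Fin 3) := fun k => EuclideanSpace.single 0 (rn k) + EuclideanSpace.single 2 (zn k)
    with hxn
  have htT : Tendsto tn atTop (𝓝 T) :=
    tendsto_tn_of_zoom_data hbdd (xn := xn) (fun k => ⟨hT2.le.trans (htn k).1, (htn k).2⟩) hlam hlam0 hnear
  by_cases hbA : BddAbove (Set.range fun k => rn k / lamn k)
  · -- ### Case A along a subsequence: axis-centred zoom
    obtain ⟨C, hC⟩ := hbA
    have hCk : ∀ k, rn k ≤ C * lamn k := fun k => by
      have h := hC ⟨k, rfl⟩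
      simp only at h
      rwa [div_le_iff₀ (hlam k)] at h
    obtain ⟨d, -, ψ, hψ, hd⟩ := tendsto_subseq_of_bounded (Metric.isBounded_Icc (0 : ℝ) C)
      (x := fun k => rn k / lamn k) fun k => ⟨div_nonneg (hrn k) (hlam k).le, hC ⟨k, rfl⟩⟩
    obtain ⟨φ₁, W, hφ₁, hW, hconv₁, hax, hsw⟩ :=
      innerLimit_caseA_data_standing hT hu haxi hE hbdd hMₛ
        (tn := tn ∘ ψ) (lamn := lamn ∘ ψ) (rn := rn ∘ ψ) (zn := zn ∘ ψ) hT2 (fun k => htn (ψ k))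
        (fun k => hlam (ψ k)) (hlam0.comp hψ.tendsto_atTop) (fun k => hgauge (ψ k))
        (hnear.comp hψ.tendsto_atTop) hd
    -- refine so that the vorticities converge too
    obtain ⟨ψ₂, hψ₂, hcurl⟩ := zoom_limit_curl_tendsto hu hE hbdd (tn := tn ∘ ψ) (lamn := lamn ∘ ψ)
      (xn := fun k => EuclideanSpace.single 2 (zn (ψ k))) hT2 (fun k => htn (ψ k)) (fun k => hlam (ψ k))
      (hlam0.comp hψ.tendsto_atTop) (fun k => hgauge (ψ k)) hφ₁ hconv₁
    set φ : ℕ → ℕ := φ₁ ∘ ψ₂ with hφdef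
    have hφ : StrictMono φ := hφ₁.comp hψ₂
    have hconv : ∀ s < 0, TendstoLocallyUniformly (fun k => ((lamn ∘ ψ) (φ k) •
        stPull ((lamn ∘ ψ) (φ k) ^ 2) ((lamn ∘ ψ) (φ k)) ((tn ∘ ψ) (φ k)) (EuclideanSpace.single 2 (zn (ψ (φ k)))) u) s)
        (W s) atTop := fun s hs => tendstoLocallyUniformly_subseq (hconv₁ s hs) hψ₂
    have hmild := zoom_limit_oseenIdentity hu hE hbdd (tn := tn ∘ ψ) (lamn := lamn ∘ ψ)
      (xn := fun k => EuclideanSpace.single 2 (zn (ψ k))) hT2 (fun k => htn (ψ k)) (fun k => hlam (ψ k))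
      (hlam0.comp hψ.tendsto_atTop) (fun k => hgauge (ψ k)) hφ hW.smooth.continuousOn hconv
    have hcax : ∀ k, (EuclideanSpace.single 2 (zn (ψ k)) : EuclideanSpace ℝ (Fin 3)) 0 = 0 ∧
        (EuclideanSpace.single 2 (zn (ψ k)) : EuclideanSpace ℝ (Fin 3)) 1 = 0 := fun k => by simp
    have hdist : ∃ D : ℝ, ∀ k, ‖xn (ψ k) - EuclideanSpace.single 2 (zn (ψ k))‖ ≤ D * (lamn ∘ ψ) k :=
      ⟨C, fun k => by
        rw [hxn, norm_meridional_sub_axisPoint, abs_of_nonneg (hrn (ψ k))]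
        exact hCk (ψ k)⟩
    refine ⟨tn ∘ ψ, lamn ∘ ψ, fun k => EuclideanSpace.single 2 (zn (ψ k)), xn ∘ ψ, φ, W, fun k => htn (ψ k),
      htT.comp hψ.tendsto_atTop, fun k => hlam (ψ k), hlam0.comp hψ.tendsto_atTop, fun k => hgauge (ψ k),
      hnear.comp hψ.tendsto_atTop, hdist, hφ, hW, hconv, hmild, hcurl, ?_⟩
    by_cases hnc : ∃ s < 0, ∃ x : EuclideanSpace ℝ (Fin 3), W s x ≠ W s 0
    · -- (β) with every rider
      have hsw' : ∃ C : ℝ, ∀ s < 0, ∀ x, |swirl (W s) x| ≤ C := ⟨Mₛ, hsw⟩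
      have hnc' : ∃ s < 0, ∃ x y : EuclideanSpace ℝ (Fin 3), W s x ≠ W s y := by
        obtain ⟨s, hs, x, hx⟩ := hnc
        exact ⟨s, hs, x, 0, hx⟩
      obtain ⟨s, hs, y, hy⟩ := typeBeta_exists_swirl_ne_zero hW hax hnc
      obtain ⟨ε₀, hε₀, hrate⟩ := typeBeta_not_swirl_rate
      exact Or.inr ⟨hcax, not_axisymmetricLiouville_of_innerLimit_typeBeta hW hax hsw' hnc, hax, hsw, hnc,
        (knssBlowupLimit_typeBeta_iff_exists_curl_ne_zero hW).1 hnc,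
        ⟨s, hs, y, hy, swirl_innerLimit_tendsto hcax hconv s hs y⟩, knssBlowupLimit_VCR_poloidal hW hax hsw',
        fun c C => hW.exists_lt_cylRadius_mul_norm_poloidal_sub_smul_eZ hax hsw' hnc' c C,
        fun q hq1 hq K => typeBeta_eLpNorm_swirl_unbounded hW hax hnc hq1 hq K,
        typeBeta_swirl_not_decay hW hax hnc, ε₀, hε₀, hrate W hW hax hsw' hnc⟩
    · -- (α): axial unit stream, vorticity → 0
      push Not at hnc
      obtain ⟨β, hβ, hWβ⟩ := innerLimit_axialUnitStream_of_const hW hmild hax hnc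
      refine Or.inl ⟨⟨β • eZ, ?_, by simp [eZ], hWβ⟩, fun s hs y => ?_⟩
      · rw [norm_smul, Real.norm_eq_abs, hβ]
        simp [eZ]
      · have hcs : W s = fun _ => β • eZ := funext (hWβ s hs)
        have h0 : curl (W s) y = 0 := by rw [hcs, curl_eq_curlCLM, fderiv_const_apply, map_zero]
        simpa [h0, hφdef, Function.comp_apply] using hcurl s hs y
  · -- ### Case B along a subsequence: (α); the centre IS the near-max point
    obtain ⟨ψ, hψ, hd⟩ := exists_subseq_tendsto_atTop_of_not_bddAbove hbA
    obtain ⟨φ₁, W, hφ₁, hW, hconv₁, hconst⟩ :=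
      innerLimit_const_caseB_standing hu haxi hE hbdd (tn := tn ∘ ψ) (lamn := lamn ∘ ψ) (rn := rn ∘ ψ)
        (zn := zn ∘ ψ) hT2 (fun k => htn (ψ k)) (fun k => hlam (ψ k)) (hlam0.comp hψ.tendsto_atTop)
        (fun k => hgauge (ψ k)) (hnear.comp hψ.tendsto_atTop) hd
    obtain ⟨ψ₂, hψ₂, hcurl⟩ := zoom_limit_curl_tendsto hu hE hbdd (tn := tn ∘ ψ) (lamn := lamn ∘ ψ)
      (xn := fun k => EuclideanSpace.single 0 (rn (ψ k)) + EuclideanSpace.single 2 (zn (ψ k))) hT2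
      (fun k => htn (ψ k)) (fun k => hlam (ψ k)) (hlam0.comp hψ.tendsto_atTop) (fun k => hgauge (ψ k)) hφ₁ hconv₁
    set φ : ℕ → ℕ := φ₁ ∘ ψ₂ with hφdef
    have hφ : StrictMono φ := hφ₁.comp hψ₂
    have hconv : ∀ s < 0, TendstoLocallyUniformly (fun k => ((lamn ∘ ψ) (φ k) •
        stPull ((lamn ∘ ψ) (φ k) ^ 2) ((lamn ∘ ψ) (φ k)) ((tn ∘ ψ) (φ k))
          (EuclideanSpace.single 0 (rn (ψ (φ k))) + EuclideanSpace.single 2 (zn (ψ (φ k)))) u) s) (W s) atTop :=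
      fun s hs => tendstoLocallyUniformly_subseq (hconv₁ s hs) hψ₂
    have hmild := zoom_limit_oseenIdentity hu hE hbdd (tn := tn ∘ ψ) (lamn := lamn ∘ ψ)
      (xn := fun k => EuclideanSpace.single 0 (rn (ψ k)) + EuclideanSpace.single 2 (zn (ψ k))) hT2
      (fun k => htn (ψ k)) (fun k => hlam (ψ k)) (hlam0.comp hψ.tendsto_atTop) (fun k => hgauge (ψ k)) hφ
      hW.smooth.continuousOn hconv
    have h1 := caseB_limit_apply_one_eq_zero hT hu haxi hbdd hMₛ (tn := tn ∘ ψ) (lamn := lamn ∘ ψ)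
      (rn := rn ∘ ψ) (zn := zn ∘ ψ) hT2 (fun k => htn (ψ k)) (fun k => hlam (ψ k))
      (hlam0.comp hψ.tendsto_atTop) (hnear.comp hψ.tendsto_atTop) hd hφ hconv
    obtain ⟨c, hc1, hc⟩ := innerLimit_unitStream_of_const hW hmild hconst
    have hdist : ∃ D : ℝ, ∀ k, ‖xn (ψ k) -
        (EuclideanSpace.single 0 (rn (ψ k)) + EuclideanSpace.single 2 (zn (ψ k)))‖ ≤ D * (lamn ∘ ψ) k :=
      ⟨0, fun k => by simp [hxn]⟩
    refine ⟨tn ∘ ψ, lamn ∘ ψ, fun k => EuclideanSpace.single 0 (rn (ψ k)) + EuclideanSpace.single 2 (zn (ψ k)),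
      xn ∘ ψ, φ, W, fun k => htn (ψ k), htT.comp hψ.tendsto_atTop, fun k => hlam (ψ k),
      hlam0.comp hψ.tendsto_atTop, fun k => hgauge (ψ k), hnear.comp hψ.tendsto_atTop, hdist, hφ, hW, hconv,
      hmild, hcurl, Or.inl ⟨⟨c, hc1, ?_, hc⟩, fun s hs y => ?_⟩⟩
    · rw [← hc (-1) (by norm_num) 0]
      exact h1 (-1) (by norm_num)
    · have hcs : W s = fun _ => c := funext (hc s hs)
      have h0 : curl (W s) y = 0 := by rw [hcs, curl_eq_curlCLM, fderiv_const_apply, map_zero]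
      simpa [h0, hφdef, Function.comp_apply] using hcurl s hs y

end MasterCore

end TypeIIModulationDictionary
end Summit.NavierStokesRegularity.OSWSelfSimilar
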